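import Mathlib

/-!
# The CHAIN lemma behind row 2′DARC (blind cell PercRepro2, night-2; proofs/NIGHT2-DARC.md §12)

Pure algebra in an ordered field. A family of «non-pivotal» branches `i ∈ s` with weights `P i ≥ 0`
and branch means `x i, y i` that are SIMILARLY ORDERED (`(x i − x j)(y i − y j) ≥ 0`), and one
«pivotal» branch of weight `Pk > 0` whose means `xk ≤ x i`, `yk ≤ y i` lie below all the others;
the global centring `(mX, mY)` is the weighted average of all branch means; on the pivotal branch
only a fraction `ρ ∈ [0, 1]` of the weight survives, with means `x′ ≤ xk`, `y′ ≤ yk`.  Then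
   `∑_{i ∈ s} P i (x i − mX)(y i − mY) + ρ Pk (x′ − mX)(y′ − mY) ≥ 0`  (`chain_alg`).
Proof: with `Δx i = x i − xk ≥ 0`, `δX = mX − xk ≥ 0`, `Q = ∑_s P`, `Ptot = Q + Pk`, one has
`∑_s P Δx = Ptot δX`, `∑_s P (x − mX)(y − mY) = ∑_s P Δx Δy − (Ptot + Pk) δX δY`, the last term is
`≥ ρ Pk δX δY`, and the weighted Chebyshev inequality `Q ∑_s P Δx Δy ≥ (∑_s P Δx)(∑_s P Δy) = Ptot² δX δY`
(`weighted_chebyshev`) gives `Q · S′ ≥ (ρ Ptot Pk + (1 − ρ) Pk²) δX δY ≥ 0`.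
This is the algebraic core of the chain theorem: 2′DARC whenever the pendant structure at the head
of the arc produces a chain of avoidance branches (pendant paths with arbitrary entries).
-/

namespace Summit.Ventures.PercRepro2.Coin

section Chebyshev

variable {ι : Type*} {R : Type*} [CommRing R]

/-- The double-sum identity behind Chebyshev's sum inequality. -/
lemma chebyshev_identity (s : Finset ι) (w a b : ι → R) :
    ∑ i ∈ s, ∑ j ∈ s, w i * w j * ((a i - a j) * (b i - b j)) =
      2 * ((∑ i ∈ s, w i) * (∑ i ∈ s, w i * a i * b i)
        - (∑ i ∈ s, w i * a i) * (∑ i ∈ s, w i * b i)) := by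
  have h : ∀ i j, w i * w j * ((a i - a j) * (b i - b j)) =
      w i * (w j * (a j * b j)) - w i * a i * (w j * b j) - w i * b i * (w j * a j)
        + w i * a i * b i * w j := by
    intro i j; ring
  simp only [h, Finset.sum_add_distrib, Finset.sum_sub_distrib, ← Finset.mul_sum, ← Finset.sum_mul]
  ring

variable [LinearOrder R] [IsStrictOrderedRing R]

/-- **Weighted Chebyshev**: for nonnegative weights and similarly ordered sequences,
`(∑ w a)(∑ w b) ≤ (∑ w)(∑ w a b)`. -/
theorem weighted_chebyshev (s : Finset ι) (w a b : ι → R) (hw : ∀ i ∈ s, 0 ≤ w i)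
    (hmono : ∀ i ∈ s, ∀ j ∈ s, 0 ≤ (a i - a j) * (b i - b j)) :
    (∑ i ∈ s, w i * a i) * (∑ i ∈ s, w i * b i) ≤ (∑ i ∈ s, w i) * (∑ i ∈ s, w i * a i * b i) := by
  have h := chebyshev_identity s w a b
  have hnn : 0 ≤ ∑ i ∈ s, ∑ j ∈ s, w i * w j * ((a i - a j) * (b i - b j)) := by
    refine Finset.sum_nonneg fun i hi => Finset.sum_nonneg fun j hj => ?_
    exact mul_nonneg (mul_nonneg (hw i hi) (hw j hj)) (hmono i hi j hj)
  rw [h] at hnn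
  linarith

end Chebyshev

section Chain

variable {ι : Type*} {R : Type*} [Field R] [LinearOrder R] [IsStrictOrderedRing R]

/-- **The chain lemma** (the centring `(mX, mY)` is given by its defining identities, no division). -/
theorem chain_alg (s : Finset ι) (P x y : ι → R) (hP : ∀ i ∈ s, 0 ≤ P i)
    (hmono : ∀ i ∈ s, ∀ j ∈ s, 0 ≤ (x i - x j) * (y i - y j))
    (Pk xk yk : R) (hPk : 0 < Pk) (hxk : ∀ i ∈ s, xk ≤ x i) (hyk : ∀ i ∈ s, yk ≤ y i)
    (ρ : R) (hρ0 : 0 ≤ ρ) (hρ1 : ρ ≤ 1) (x' y' : R) (hx' : x' ≤ xk) (hy' : y' ≤ yk)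
    (Ptot mX mY : R) (hPtot : Ptot = (∑ i ∈ s, P i) + Pk)
    (hmX : mX * Ptot = (∑ i ∈ s, P i * x i) + Pk * xk)
    (hmY : mY * Ptot = (∑ i ∈ s, P i * y i) + Pk * yk) :
    0 ≤ (∑ i ∈ s, P i * (x i - mX) * (y i - mY)) + ρ * Pk * (x' - mX) * (y' - mY) := by
  set Q := ∑ i ∈ s, P i with hQ
  have hQ0 : 0 ≤ Q := Finset.sum_nonneg hP
  have hPtot0 : 0 < Ptot := by rw [hPtot]; linarith
  set δX := mX - xk with hδX
  set δY := mY - yk with hδY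
  -- ∑_s P (x − xk) = Ptot δX
  have hsumX : ∑ i ∈ s, P i * (x i - xk) = Ptot * δX := by
    have e : ∑ i ∈ s, P i * (x i - xk) = (∑ i ∈ s, P i * x i) - Q * xk := by
      simp only [mul_sub, Finset.sum_sub_distrib, hQ, Finset.sum_mul]
    rw [e, hδX]
    linear_combination (-1 : R) * hmX + xk * hPtot
  have hsumY : ∑ i ∈ s, P i * (y i - yk) = Ptot * δY := by
    have e : ∑ i ∈ s, P i * (y i - yk) = (∑ i ∈ s, P i * y i) - Q * yk := by
      simp only [mul_sub, Finset.sum_sub_distrib, hQ, Finset.sum_mul]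
    rw [e, hδY]
    linear_combination (-1 : R) * hmY + yk * hPtot
  -- δ ≥ 0
  have hδX0 : 0 ≤ δX := by
    have h1 : 0 ≤ ∑ i ∈ s, P i * (x i - xk) :=
      Finset.sum_nonneg fun i hi => mul_nonneg (hP i hi) (by linarith [hxk i hi])
    rw [hsumX] at h1
    exact (mul_nonneg_iff_of_pos_left hPtot0).mp h1
  have hδY0 : 0 ≤ δY := by
    have h1 : 0 ≤ ∑ i ∈ s, P i * (y i - yk) :=
      Finset.sum_nonneg fun i hi => mul_nonneg (hP i hi) (by linarith [hyk i hi])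
    rw [hsumY] at h1
    exact (mul_nonneg_iff_of_pos_left hPtot0).mp h1
  have hδ : 0 ≤ δX * δY := mul_nonneg hδX0 hδY0
  -- the non-pivotal sum in terms of the Δ's
  have hexp : ∑ i ∈ s, P i * (x i - mX) * (y i - mY) =
      (∑ i ∈ s, P i * (x i - xk) * (y i - yk)) - (Ptot + Pk) * (δX * δY) := by
    have h : ∀ i, P i * (x i - mX) * (y i - mY) =
        P i * (x i - xk) * (y i - yk) - δY * (P i * (x i - xk)) - δX * (P i * (y i - yk))
          + (δX * δY) * P i := by
      intro i; simp only [hδX, hδY]; ring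
    simp only [h, Finset.sum_add_distrib, Finset.sum_sub_distrib, ← Finset.mul_sum, hsumX, hsumY]
    rw [← hQ, hPtot]; ring
  -- the pivotal term is at least ρ Pk δX δY
  have hlast : ρ * Pk * (δX * δY) ≤ ρ * Pk * (x' - mX) * (y' - mY) := by
    have h1 : δX ≤ -(x' - mX) := by simp only [hδX]; linarith
    have h2 : δY ≤ -(y' - mY) := by simp only [hδY]; linarith
    have h3 : δX * δY ≤ (-(x' - mX)) * (-(y' - mY)) :=
      mul_le_mul h1 h2 hδY0 (by linarith)
    have h4 : (-(x' - mX)) * (-(y' - mY)) = (x' - mX) * (y' - mY) := by ring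
    rw [h4] at h3
    have h5 : 0 ≤ ρ * Pk := mul_nonneg hρ0 hPk.le
    have h6 := mul_le_mul_of_nonneg_left h3 h5
    calc ρ * Pk * (δX * δY) ≤ ρ * Pk * ((x' - mX) * (y' - mY)) := h6
      _ = ρ * Pk * (x' - mX) * (y' - mY) := by ring
  -- Chebyshev on the non-pivotal branches
  have hcheb := weighted_chebyshev s P (fun i => x i - xk) (fun i => y i - yk) hP
    (fun i hi j hj => by
      have := hmono i hi j hj
      have e : (x i - xk - (x j - xk)) * (y i - yk - (y j - yk)) = (x i - x j) * (y i - y j) := by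
        ring
      show 0 ≤ (x i - xk - (x j - xk)) * (y i - yk - (y j - yk))
      rw [e]; exact this)
  rw [hsumX, hsumY] at hcheb
  have hQS : Ptot * Ptot * (δX * δY) ≤ Q * ∑ i ∈ s, P i * (x i - xk) * (y i - yk) := by
    have e : Ptot * Ptot * (δX * δY) = (Ptot * δX) * (Ptot * δY) := by ring
    rw [e]; exact hcheb
  -- S′ ≥ ∑ P Δx Δy − (Ptot + Pk − ρ Pk) δX δY
  have hS : (∑ i ∈ s, P i * (x i - xk) * (y i - yk)) - (Ptot + Pk - ρ * Pk) * (δX * δY) ≤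
      (∑ i ∈ s, P i * (x i - mX) * (y i - mY)) + ρ * Pk * (x' - mX) * (y' - mY) := by
    rw [hexp]; linarith
  rcases eq_or_lt_of_le hQ0 with hQz | hQpos
  · -- Q = 0: every P i vanishes, hence δ = 0 and the non-pivotal sum is 0
    have hall : ∀ i ∈ s, P i = 0 :=
      (Finset.sum_eq_zero_iff_of_nonneg hP).mp (by rw [← hQ]; exact hQz.symm)
    have hsum0 : ∑ i ∈ s, P i * (x i - xk) * (y i - yk) = 0 :=
      Finset.sum_eq_zero fun i hi => by rw [hall i hi]; ring
    have hsum1 : ∑ i ∈ s, P i * (x i - mX) * (y i - mY) = 0 :=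
      Finset.sum_eq_zero fun i hi => by rw [hall i hi]; ring
    have hδX' : Ptot * δX = 0 := by
      rw [← hsumX]
      exact Finset.sum_eq_zero fun i hi => by rw [hall i hi]; ring
    have hδX0' : δX = 0 := (mul_eq_zero.mp hδX').resolve_left hPtot0.ne'
    rw [hsum1]
    have : ρ * Pk * (δX * δY) = 0 := by rw [hδX0']; ring
    linarith [hlast]
  · -- Q > 0: Q · S′ ≥ (ρ Ptot Pk + (1 − ρ) Pk²) δX δY ≥ 0
    have e1 := mul_le_mul_of_nonneg_left hS hQ0
    have e2 : Q * ((∑ i ∈ s, P i * (x i - xk) * (y i - yk)) - (Ptot + Pk - ρ * Pk) * (δX * δY)) =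
        Q * ∑ i ∈ s, P i * (x i - xk) * (y i - yk) - Q * (Ptot + Pk - ρ * Pk) * (δX * δY) := by
      ring
    have e3 : Ptot * Ptot * (δX * δY) - Q * (Ptot + Pk - ρ * Pk) * (δX * δY) =
        (ρ * Ptot * Pk + (1 - ρ) * Pk * Pk) * (δX * δY) := by
      rw [hPtot]; ring
    have hcoef : 0 ≤ ρ * Ptot * Pk + (1 - ρ) * Pk * Pk := by
      have := mul_nonneg (mul_nonneg hρ0 hPtot0.le) hPk.le
      have := mul_nonneg (mul_nonneg (by linarith : (0:R) ≤ 1 - ρ) hPk.le) hPk.le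
      linarith
    have key : (ρ * Ptot * Pk + (1 - ρ) * Pk * Pk) * (δX * δY) ≤
        Q * ((∑ i ∈ s, P i * (x i - mX) * (y i - mY)) + ρ * Pk * (x' - mX) * (y' - mY)) := by
      linarith [e1, e2, e3, hQS]
    have := mul_nonneg hcoef hδ
    exact (mul_nonneg_iff_of_pos_left hQpos).mp (by linarith)

end Chain

end Summit.Ventures.PercRepro2.Coin
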